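import Summits.BirchSwinnertonDyer.BirchSwinnertonDyer.Theorems.ClassRecordThreeEulerHalvesAtThreeShimuraE0Descent
import Summits.BirchSwinnertonDyer.BirchSwinnertonDyer.Theorems.ClassRecordThreeCornerAtThreeShimuraWalkDefs
import Literature.NumberTheory.EllipticCurves.RingClassGalOverCyclicProofs
import Literature.NumberTheory.EllipticCurves.TamagawaNeZeroProofs
import HarnessLib

/-!
# Gross's E′-LABEL at a K-split carrier of the carrier-inert Shimura road from (B4), two LOCAL E₀-inputs and an auxiliary inert level
# («an auxiliary norm kills the component», bsd-idea-9 g7∕g8) — cell `bsd-stepL`, seat `bsd-stepL-tam3-p1` g18, LINE OWNER of crux 19109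
# `EulerHalvesAtThree`; `--supports stmt-BirchSwinnertonDyer-19109 --as helper` (route-free; generic prime `p`, generic carrier `q`)

WHY. Line `Lines/inert.lean` r16 of 19109 carries ONE beyond-print object, the identity-component label (B6) at the carrier primes `q ∉ S`
(`3 ∣ c_q(E/ℚ_q)`: additive IV∕IV* or split `I_n`, K-SPLIT on the frame). Width seat er5-w3 g5 re-threaded its two consumers on Gross's
weaker **E′-label** «some prime-to-`p` multiple `n' • ys m` lies in `E₀(K[m])_w` at every guarded level `m`, every `w ∣ q`» (LMS 1991
p. 245; binder `hE0T` of `…EulerHalfNotRamE0PrimeReceptacle`). THIS FILE derives that E′-label at ONE carrier `q` from (B4) (Gross's norm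
relation, fifth conjunct of `ShimuraWalk.LabelsAt`, valid at EVERY square-free level on inert good primes) and three HYPOTHESES:
(T) at every level `n ≠ 0`, `q ∤ n`, every place `w ∋ q` of `K[n]`, every `τ ∈ Aut_ℚ(K[n])` fixing `w` acts TRIVIALLY on `E(K[n]) ∕ E₀,w`;
(C) a natural number `c` (intended `c_q(E/ℚ_q)`) KILLS `E(K[n]) ∕ E₀,w` [both: Kodaira–Néron ∕ Tate at a carrier — all geometric components
are `𝔽_q`-rational, so `E(ℚ_q) ∕ E₀ → E(K[n]_w^{nr}) ∕ E₀` is onto]; (AUX) VERBATIM the body of bsd-idea-9 g8's `AuxiliaryInertLevel` (for every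
`e, m₀` a good inert `ℓ₀ ∤ N m₀` with `p ∤ a_{ℓ₀}`, `σ_{ℓ₀}^{ℓ₀+1} = 1`, `p^e ∣ #Stab_{⟨σ_{ℓ₀}⟩}(w̃)` at every `w̃ ∋ q`; ring class CFT + Chebotarev).
MECHANISM: at level `n = ℓ₀ m₀`, in `A = E(K[n]) ∕ E₀,w̃`, (B4) reads `a_{ℓ₀} • [ys m₀] = ∑_{i ≤ ℓ₀} [σ^i ys n]`; by (T) the summand is
invariant under the stabiliser `D` of `w̃` in the abelian `⟨σ⟩`, so the sum lies in `#D • A ⊆ p^e A` ((A1″) orbit counting); Bezout with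
`p ∤ a_{ℓ₀}` and (C) give `(c ∕ p^e) • ys m₀ ∈ E₀,w̃`; then DESCEND `E₀` from `K[n]` to `K[m₀]` (Mathlib `valuation_liesOver` + the tree's
`hasNonsingularReduction_some_iff_of_ringHom`). The exponent `n' = c ∕ p^{ord_p c}` is uniform in the level.
Generic lemmas (orbit counting (A1″), Bezout (A2), the descent of `E₀`) are `…ShimuraE0Descent` (same seat). Here:
`labelE0Prime_at_carrier_of_galTrivial_of_kills_of_auxLevel` (conclusion VERBATIM the per-prime body of `hE0T`) and
`carrierLabelsE0Prime_of_galTrivial_of_kills_of_auxLevel` (the binder `hE0T` on a frame, from per-carrier inputs).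
HONEST FRAMING: THEOREMS ONLY (no definition, no named fact, no `sorry`); (T), (C), (AUX), the labels are HYPOTHESES; nothing is asserted
about any CM point; no stub ∕ item closes; 19109 OPEN; BSD is proved for no curve (T7).
-- adapted from Summits/…/Cruxes/EulerHalfNotRamNoInertSetAtFive/Lines/aux_norm_receptacle.lean §2 (bsd-idea-9 g8): the shape of its
-- `labelE0Prime_at_splitCarrier_of_stubs` with the component characters (K1)–(K3) replaced by (T), (C).
References (locators only): [cite: GrossLMS1991, §3 Prop. 3.7 (1) (p. 239), §6 proof of Prop. 6.2 (1) (p. 245 «E′»)]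
[cite: SilvermanATAEC1994, IV Cor. 9.2 (d), IV §9] [cite: SilvermanAEC2009, VII Prop. 2.1] [cite: NeukirchANT1999, Ch. II (8.1)–(8.2)].
presearch: «auxiliary prime norm relation kills component group Heegner point» → none as a lemma (corpus fts+vec, galaxy "component
group|Heegner"); nearest [corpus:GrossLMS1991 p.245] «E′» (currency) and bsd-idea-9's card `aux-norm-receptacle` (mechanism, kernel-checked core).
Axioms: `propext`, `Classical.choice`, `Quot.sound`.
-/

set_option autoImplicit false
set_option linter.dupNamespace false

noncomputable section

open scoped Classical NumberField Pointwise

namespace Summit.BirchSwinnertonDyer.BirchSwinnertonDyer.Theorems.ShimuraWalk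

open WeierstrassCurve IsDedekindDomain NumberField Field Literature.NumberTheory.EllipticCurves

/-! ### The E′-label at a carrier from (B4), (T), (C) and an auxiliary inert level -/

section Composition

variable (W : WeierstrassCurve ℚ) [W.IsElliptic] [W.IsGloballyMinimal] {K : Type} [Field K] [NumberField K]
  (ι : K →+* ℂ)

set_option maxHeartbeats 1600000 in
/-- **The E′-label at a K-split carrier `q` from (B4), the two local E₀-inputs (T), (C) and an auxiliary inert level.** `K` imaginary
quadratic with its ring class tower `K[·] ⊂ ℂ`, a prime `p`, a prime `q ∣ N`, a natural number `c ≠ 0` (intended `c_q(E/ℚ_q)`), a family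
`ys` carrying the printed labels `LabelsAt` (only (B4) is used), and the three HYPOTHESES
(T) `hT`: at every level `n ≠ 0`, `q ∤ n`, every place `w ∋ q` of `K[n]` and every `τ ∈ Aut_ℚ(K[n])` with `τ • w = w`: `τ P − P ∈ E₀(K[n])_w`;
(C) `hC`: there, `c • P ∈ E₀(K[n])_w` for every `P`;
(AUX) `hAux`: VERBATIM the body of bsd-idea-9's `AuxiliaryInertLevel W K ι p q N`.
THEN there is ONE `n'` prime to `p` (namely `c ∕ p^{ord_p c}`) with `n' • ys m ∈ E₀(K[m])_w` at every guarded level `m` and every place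
`w ∋ q` — VERBATIM the per-prime body of the binder `hE0T` of er5-w3's `…_of_tamagawa_of_E0Prime` ∕ `…_of_labelE0Prime_singleton`.
[cite: GrossLMS1991, §3 Prop. 3.7 (1), §6 p. 245] [cite: SilvermanATAEC1994, IV Cor. 9.2 (d)] -/
theorem labelE0Prime_at_carrier_of_galTrivial_of_kills_of_auxLevel [∀ j : ℕ, NumberField (ringClassField K ι j)]
    (hK : IsImaginaryQuadratic K) {p : ℕ} [Fact p.Prime] {q : ℕ} [Fact q.Prime] {N : ℕ} (hqN : q ∣ N)
    {c : ℕ} (hc0 : c ≠ 0)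
    (hT : ∀ n : ℕ, n ≠ 0 → ¬ q ∣ n → ∀ (w : HeightOneSpectrum (𝓞 (ringClassField K ι n))),
      ((q : ℕ) : 𝓞 (ringClassField K ι n)) ∈ w.asIdeal →
      ∀ τ : ringClassField K ι n ≃ₐ[ℚ] ringClassField K ι n, τ • w.asIdeal = w.asIdeal →
      ∀ P : (W.baseChange (ringClassField K ι n)).toAffine.Point,
        (placeIntModel W (ringClassField K ι n) w).HasNonsingularReduction (K := ringClassField K ι n)
          (pointGalHom W (ringClassField K ι n) τ P - P))
    (hC : ∀ n : ℕ, n ≠ 0 → ¬ q ∣ n → ∀ (w : HeightOneSpectrum (𝓞 (ringClassField K ι n))),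
      ((q : ℕ) : 𝓞 (ringClassField K ι n)) ∈ w.asIdeal →
      ∀ P : (W.baseChange (ringClassField K ι n)).toAffine.Point,
        (placeIntModel W (ringClassField K ι n) w).HasNonsingularReduction (K := ringClassField K ι n) (c • P))
    (hAux : ∀ e m₀ : ℕ, Squarefree m₀ → (∀ r ∈ m₀.primeFactors, ¬ r ∣ N ∧ (Ideal.span {(r : 𝓞 K)}).IsPrime) →
      ∃ ℓ₀ : ℕ, ℓ₀.Prime ∧ ¬ ℓ₀ ∣ N ∧ ¬ ℓ₀ ∣ m₀ ∧ (Ideal.span {(ℓ₀ : 𝓞 K)}).IsPrime ∧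
        ¬ (p : ℤ) ∣ W.frobeniusTrace ℓ₀ ∧
        ∀ σ : ringClassField K ι (ℓ₀ * m₀) ≃ₐ[ℚ] ringClassField K ι (ℓ₀ * m₀),
          Subgroup.zpowers σ = ringClassGalOver ι (ℓ₀ * m₀) m₀ →
          σ ^ (ℓ₀ + 1) = 1 ∧
          ∀ w : HeightOneSpectrum (𝓞 (ringClassField K ι (ℓ₀ * m₀))),
            ((q : ℕ) : 𝓞 (ringClassField K ι (ℓ₀ * m₀))) ∈ w.asIdeal →
            p ^ e ∣ Nat.card (MulAction.stabilizer (Subgroup.zpowers σ) w.asIdeal))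
    (ys : (m : ℕ) → (W.baseChange (ringClassField K ι m)).toAffine.Point)
    {y : (W.baseChange K).toAffine.Point} {ε : ℤ} (hLab : LabelsAt W N K ι y ys ε) :
    ∃ n' : ℕ, ¬ p ∣ n' ∧ ∀ m : ℕ, Squarefree m → (∀ r ∈ m.primeFactors, ¬ r ∣ N ∧ (Ideal.span {(r : 𝓞 K)}).IsPrime) →
      ∀ [NumberField (ringClassField K ι m)] (w : HeightOneSpectrum (𝓞 (ringClassField K ι m))),
        ((q : ℕ) : 𝓞 (ringClassField K ι m)) ∈ w.asIdeal →
        (placeIntModel W (ringClassField K ι m) w).HasNonsingularReduction (K := ringClassField K ι m) (n' • ys m) := by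
  have hp : p.Prime := Fact.out
  have hq : q.Prime := Fact.out
  set e : ℕ := c.factorization p with he
  have hpe : p ^ e ∣ c := Nat.ordProj_dvd _ _
  refine ⟨c / p ^ e, Nat.not_dvd_ordCompl hp hc0, fun m₀ hm₀ hg₀ _ w₀ hw₀ ↦ ?_⟩
  -- the auxiliary level `ℓ₀ m₀`
  obtain ⟨ℓ₀, hℓ₀, hℓ₀N, hℓ₀m, hℓ₀P, haℓ, hgrp⟩ := hAux e m₀ hm₀ hg₀
  have hm0 : m₀ ≠ 0 := hm₀.ne_zero
  have hM0 : ℓ₀ * m₀ ≠ 0 := mul_ne_zero hℓ₀.ne_zero hm0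
  have hqm : ¬ q ∣ m₀ := fun h ↦ (hg₀ q (Nat.mem_primeFactors.mpr ⟨hq, h, hm0⟩)).1 hqN
  have hqℓ : q ≠ ℓ₀ := fun h ↦ hℓ₀N (h ▸ hqN)
  have hqM : ¬ q ∣ ℓ₀ * m₀ := fun h ↦ ((Nat.Prime.dvd_mul hq).mp h).elim
    (fun h1 ↦ hqℓ ((Nat.prime_dvd_prime_iff_eq hq hℓ₀).mp h1)) hqm
  have hsqM : Squarefree (ℓ₀ * m₀) :=
    (Nat.squarefree_mul ((Nat.Prime.coprime_iff_not_dvd hℓ₀).mpr hℓ₀m)).mpr ⟨hℓ₀.prime.squarefree, hm₀⟩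
  have hgM : ∀ r ∈ (ℓ₀ * m₀).primeFactors, ¬ r ∣ N ∧ (Ideal.span {(r : 𝓞 K)}).IsPrime := by
    intro r hr
    rw [Nat.primeFactors_mul hℓ₀.ne_zero hm0, Finset.mem_union] at hr
    rcases hr with hr | hr
    · rw [hℓ₀.primeFactors, Finset.mem_singleton] at hr
      subst hr
      exact ⟨hℓ₀N, hℓ₀P⟩
    · exact hg₀ r hr
  have hℓmem : ℓ₀ ∈ (ℓ₀ * m₀).primeFactors := Nat.mem_primeFactors.mpr ⟨hℓ₀, dvd_mul_right _ _, hM0⟩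
  -- a generator `σ` of `G_{ℓ₀}`; work at the level pair `(ℓ₀ m₀, ℓ₀ m₀ / ℓ₀)` and transport to `m₀` at the end
  obtain ⟨σ, hσ⟩ := RingClassGalOverCyclic.exists_zpowers_eq_ringClassGalOver_mul hK ι hm0 hℓ₀ hℓ₀m hℓ₀P
  obtain ⟨hσn, hstab⟩ := hgrp σ hσ
  have hdiv : ℓ₀ * m₀ / ℓ₀ = m₀ := Nat.mul_div_cancel_left m₀ hℓ₀.pos
  have hle' : ringClassField K ι (ℓ₀ * m₀ / ℓ₀) ≤ ringClassField K ι (ℓ₀ * m₀) :=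
    ringClassField_div_le hK ι (dvd_mul_right ℓ₀ m₀) hM0
  have hσ' : Subgroup.zpowers σ = ringClassGalOver ι (ℓ₀ * m₀) (ℓ₀ * m₀ / ℓ₀) := by rw [hdiv]; exact hσ
  -- (B4) at level `ℓ₀ m₀` with `ℓ = ℓ₀`
  have h4 := hLab.2.2.2.2.1 (ℓ₀ * m₀) hsqM hgM ℓ₀ hℓmem hle' σ hσ'
  obtain ⟨f, h4f, -⟩ : ∃ f : ringClassField K ι (ℓ₀ * m₀ / ℓ₀) →ₐ[ℚ] ringClassField K ι (ℓ₀ * m₀),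
      _ = W.frobeniusTrace ℓ₀ • WeierstrassCurve.Affine.Point.map (W' := W) f (ys (ℓ₀ * m₀ / ℓ₀)) ∧
      (∀ x : ringClassField K ι (ℓ₀ * m₀ / ℓ₀), ((f x : ringClassField K ι (ℓ₀ * m₀)) : ℂ) = (x : ℂ)) :=
    ⟨_, h4, fun x ↦ RingClassField.coe_inclusion ι hle' x⟩
  -- the E′-label at level `ℓ₀ m₀ / ℓ₀`, read at level `ℓ₀ m₀` at every place `w̃ ∋ q`, then descended (`hasNonsingularReduction_of_forall_place_map`)
  have hup : ∀ (wt : HeightOneSpectrum (𝓞 (ringClassField K ι (ℓ₀ * m₀)))),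
      ((q : ℕ) : 𝓞 (ringClassField K ι (ℓ₀ * m₀))) ∈ wt.asIdeal →
      (placeIntModel W (ringClassField K ι (ℓ₀ * m₀)) wt).HasNonsingularReduction (K := ringClassField K ι (ℓ₀ * m₀))
        (Affine.Point.map (W' := W) f ((c / p ^ e) • ys (ℓ₀ * m₀ / ℓ₀))) := by
    intro wt hwtq
    -- the quotient `A = E(K[ℓ₀ m₀]) ∕ E₀,w̃`
    let H : AddSubgroup (W.baseChange (ringClassField K ι (ℓ₀ * m₀))).toAffine.Point :=
      { carrier := {P | (placeIntModel W (ringClassField K ι (ℓ₀ * m₀)) wt).HasNonsingularReduction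
            (K := ringClassField K ι (ℓ₀ * m₀)) P}
        zero_mem' := WeierstrassCurve.hasNonsingularReduction_zero (K := ringClassField K ι (ℓ₀ * m₀))
          (W := placeIntModel W (ringClassField K ι (ℓ₀ * m₀)) wt)
        add_mem' := fun hP hQ ↦ MemE0ModRatTorsion.hasNonsingularReduction_placeIntModel_add hP hQ
        neg_mem' := fun hP ↦ MemE0ModRatTorsion.hasNonsingularReduction_placeIntModel_neg hP }
    set mk : (W.baseChange (ringClassField K ι (ℓ₀ * m₀))).toAffine.Point →+
        (W.baseChange (ringClassField K ι (ℓ₀ * m₀))).toAffine.Point ⧸ H := QuotientAddGroup.mk' H with hmk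
    have hmem : ∀ P : (W.baseChange (ringClassField K ι (ℓ₀ * m₀))).toAffine.Point, mk P = 0 ↔
        (placeIntModel W (ringClassField K ι (ℓ₀ * m₀)) wt).HasNonsingularReduction
          (K := ringClassField K ι (ℓ₀ * m₀)) P := by
      intro P
      rw [hmk, QuotientAddGroup.mk'_apply, QuotientAddGroup.eq_zero_iff]
      rfl
    -- (B4) read in `A`
    have key := congrArg mk h4f
    rw [map_sum, map_zsmul] at key
    -- orbit counting ((A1″) of `…ShimuraE0Descent`) with the stabiliser-invariance from (T)
    obtain ⟨t, ht⟩ := exists_sum_range_eq_card_stabilizer_nsmul_of_invariant σ hσn wt.asIdeal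
      (fun g ↦ mk (pointGalHom W (ringClassField K ι (ℓ₀ * m₀)) g (ys (ℓ₀ * m₀)))) (fun g d _ hd ↦ by
        rw [map_mul]
        change mk (pointGalHom W (ringClassField K ι (ℓ₀ * m₀)) d
          (pointGalHom W (ringClassField K ι (ℓ₀ * m₀)) g (ys (ℓ₀ * m₀)))) = _
        rw [← sub_eq_zero, ← map_sub, hmem]
        exact hT (ℓ₀ * m₀) hM0 hqM wt hwtq d hd _)
    rw [ht] at key
    -- (A2): `(c / p^e) • [f (ys _)] = 0`
    have hap : IsCoprime (W.frobeniusTrace ℓ₀) (p : ℤ) :=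
      ((Prime.coprime_iff_not_dvd (Nat.prime_iff_prime_int.mp hp)).mpr haℓ).symm
    have hkill : ∀ z : (W.baseChange (ringClassField K ι (ℓ₀ * m₀))).toAffine.Point ⧸ H, c • z = 0 := by
      intro z
      induction z using QuotientAddGroup.induction_on with
      | H P =>
        change c • mk P = 0
        rw [← map_nsmul, hmem]
        exact hC (ℓ₀ * m₀) hM0 hqM wt hwtq P
    have h0 := nsmul_ordCompl_eq_zero_of_smul_eq_card_nsmul hp.ne_zero hap hpe (hstab wt hwtq) hkill key.symm
    rw [← map_nsmul, hmem, ← map_nsmul] at h0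
    exact h0
  have hfin := hasNonsingularReduction_of_forall_place_map W f q ((c / p ^ e) • ys (ℓ₀ * m₀ / ℓ₀)) hup
  rw [hdiv] at hfin
  exact hfin w₀ hw₀

/-- **The binder `hE0T` on a Shimura frame from the per-carrier inputs.** For every prime `q ∣ N` outside `S` with `p ∣ c_q(E/ℚ_q)`:
(T) and (C) (with `c := c_q(E/ℚ_q)`) at the places over `q` of every `K[n]`, `q ∤ n`, and the auxiliary inert level at `(p, q, N)` —
all HYPOTHESES — give, with (B4) of `LabelsAt`, the E′-labels at every carrier outside `S`: VERBATIM the hypothesis `hE0T` of er5-w3's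
`ShimuraWalk.kolyvaginClass_familyData_mem_selmerLocalKer_of_labelsAt_of_tamagawa_of_E0Prime` and (per prime) of
`…localization_kolyvaginClass_familyData_mem_stringentFamily_of_labelE0Prime_singleton`. [cite: GrossLMS1991, §6 proof of Prop. 6.2 (1), p. 245] -/
theorem carrierLabelsE0Prime_of_galTrivial_of_kills_of_auxLevel [∀ j : ℕ, NumberField (ringClassField K ι j)]
    (hK : IsImaginaryQuadratic K) {p : ℕ} [Fact p.Prime] {N : ℕ} {S : Finset ℕ}
    (hT : ∀ (q : ℕ) [Fact q.Prime], q ∣ N → q ∉ S → p ∣ (W.baseChange ℚ_[q]).localTamagawaNumber ℤ_[q] →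
      ∀ n : ℕ, n ≠ 0 → ¬ q ∣ n → ∀ (w : HeightOneSpectrum (𝓞 (ringClassField K ι n))),
      ((q : ℕ) : 𝓞 (ringClassField K ι n)) ∈ w.asIdeal →
      ∀ τ : ringClassField K ι n ≃ₐ[ℚ] ringClassField K ι n, τ • w.asIdeal = w.asIdeal →
      ∀ P : (W.baseChange (ringClassField K ι n)).toAffine.Point,
        (placeIntModel W (ringClassField K ι n) w).HasNonsingularReduction (K := ringClassField K ι n)
          (pointGalHom W (ringClassField K ι n) τ P - P))
    (hC : ∀ (q : ℕ) [Fact q.Prime], q ∣ N → q ∉ S → p ∣ (W.baseChange ℚ_[q]).localTamagawaNumber ℤ_[q] →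
      ∀ n : ℕ, n ≠ 0 → ¬ q ∣ n → ∀ (w : HeightOneSpectrum (𝓞 (ringClassField K ι n))),
      ((q : ℕ) : 𝓞 (ringClassField K ι n)) ∈ w.asIdeal →
      ∀ P : (W.baseChange (ringClassField K ι n)).toAffine.Point,
        (placeIntModel W (ringClassField K ι n) w).HasNonsingularReduction (K := ringClassField K ι n)
          ((W.baseChange ℚ_[q]).localTamagawaNumber ℤ_[q] • P))
    (hAux : ∀ (q : ℕ) [Fact q.Prime], q ∣ N → q ∉ S → p ∣ (W.baseChange ℚ_[q]).localTamagawaNumber ℤ_[q] →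
      ∀ e m₀ : ℕ, Squarefree m₀ → (∀ r ∈ m₀.primeFactors, ¬ r ∣ N ∧ (Ideal.span {(r : 𝓞 K)}).IsPrime) →
      ∃ ℓ₀ : ℕ, ℓ₀.Prime ∧ ¬ ℓ₀ ∣ N ∧ ¬ ℓ₀ ∣ m₀ ∧ (Ideal.span {(ℓ₀ : 𝓞 K)}).IsPrime ∧
        ¬ (p : ℤ) ∣ W.frobeniusTrace ℓ₀ ∧
        ∀ σ : ringClassField K ι (ℓ₀ * m₀) ≃ₐ[ℚ] ringClassField K ι (ℓ₀ * m₀),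
          Subgroup.zpowers σ = ringClassGalOver ι (ℓ₀ * m₀) m₀ →
          σ ^ (ℓ₀ + 1) = 1 ∧
          ∀ w : HeightOneSpectrum (𝓞 (ringClassField K ι (ℓ₀ * m₀))),
            ((q : ℕ) : 𝓞 (ringClassField K ι (ℓ₀ * m₀))) ∈ w.asIdeal →
            p ^ e ∣ Nat.card (MulAction.stabilizer (Subgroup.zpowers σ) w.asIdeal))
    (ys : (m : ℕ) → (W.baseChange (ringClassField K ι m)).toAffine.Point)
    {y : (W.baseChange K).toAffine.Point} {ε : ℤ} (hLab : LabelsAt W N K ι y ys ε) :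
    ∀ (q : ℕ) [Fact q.Prime], q ∣ N → q ∉ S → p ∣ (W.baseChange ℚ_[q]).localTamagawaNumber ℤ_[q] →
      ∃ n' : ℕ, ¬ p ∣ n' ∧ ∀ m : ℕ, Squarefree m → (∀ r ∈ m.primeFactors, ¬ r ∣ N ∧ (Ideal.span {(r : 𝓞 K)}).IsPrime) →
        ∀ [NumberField (ringClassField K ι m)] (w : HeightOneSpectrum (𝓞 (ringClassField K ι m))),
          ((q : ℕ) : 𝓞 (ringClassField K ι m)) ∈ w.asIdeal →
          (placeIntModel W (ringClassField K ι m) w).HasNonsingularReduction (K := ringClassField K ι m) (n' • ys m) := by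
  intro q _ hqN hqS htam
  haveI : (W.baseChange ℚ_[q]).IsElliptic := inferInstanceAs (W.map (algebraMap ℚ ℚ_[q])).IsElliptic
  have hc0 : (W.baseChange ℚ_[q]).localTamagawaNumber ℤ_[q] ≠ 0 :=
    localTamagawaNumber_padic_ne_zero_holds q (W.baseChange ℚ_[q])
  exact labelE0Prime_at_carrier_of_galTrivial_of_kills_of_auxLevel W ι hK hqN hc0 (hT q hqN hqS htam) (hC q hqN hqS htam)
    (hAux q hqN hqS htam) ys hLab

end Composition

end Summit.BirchSwinnertonDyer.BirchSwinnertonDyer.Theorems.ShimuraWalk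

end
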